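import Mathlib.Algebra.Order.BigOperators.Group.Finset
import Mathlib.Algebra.BigOperators.Ring.Finset
import Mathlib.Data.Real.Basic
import Mathlib.Tactic.Linarith
import Mathlib.Tactic.Ring
import HarnessLib

/-!
# `NoHeavyLowerTail` (stmt-CriticalPhenomena-4575) — the vertical-collapse ("top-region peeling") lemma, abstract form

Support file, seat `prim-l12-p5` (gen 18), `--supports stmt-CriticalPhenomena-4575`.  Standard axioms, no sorries, no definitions.
This is the combinatorial skeleton of the TOP-REGION PEELING THEOREM for the free-slot hitting inequality F(n+1,1)∀X
(memo FROM-prim-l12-p5-g18-TOP-PEELING §1, proof note PEELING-PROOF-g18.md §3–4): the cells of a configuration `C` with a top region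
are `(R, b)` with `R` a cell of `C' = C ∖ O` and `b` = "top region open"; the free-slot measure of `C` gives the pair the weights
`λ·P'(R)·z(R)` (top closed) and `(1−λ)·P'(R)·z_O` (top open, always a full cell), while `C'` gives `R` the weight `P'(R)·z'(R)`.
If `z_O ≥ 0`, `z'_O ≥ 0` and the PATTERN inequalities `z'_O·(λ z(R) + (1−λ) z_O) ≥ z_O·z'(R)` hold, then for every set `U` of cells
that is upward closed in the top coordinate, `z'_O · ν_C(U) ≥ z_O · ν_{C'}(U⁰)`.  The Sahi-specific inputs (the identification of the
weights via `SahiFreeSlot.zDen`, and the certified pattern inequalities at orders 3–5) are separate.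
[this work]
-/

namespace Summit.CriticalPhenomena.PercolationContinuityZ3.Theorems

namespace SahiFreeSlot

open Finset

variable {N : Type*} [Fintype N] [DecidableEq N]

/-- **Vertical collapse / top-region peeling (abstract).**  Cells `N × Bool` (second coordinate = top region open), weights
`w (R,false) = lam·P' R·z R`, `w (R,true) = (1−lam)·P' R·zO`; `U` upward closed in the Bool coordinate.  If `0 ≤ zO`, `0 ≤ zO'`,
`0 ≤ P'`, `lam ≤ 1` and `zO'·(lam·z R + (1−lam)·zO) ≥ zO·z' R` for all `R`, then
`zO' · Σ_{c ∈ U} w c ≥ zO · Σ_{R : (R,false) ∈ U} P' R · z' R`. [this work] -/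
theorem peel_collapse (P' z z' : N → ℝ) (zO zO' lam : ℝ) (U : Finset (N × Bool))
    (hU : ∀ R, (R, false) ∈ U → (R, true) ∈ U)
    (hzO : 0 ≤ zO) (hzO' : 0 ≤ zO') (hP : ∀ R, 0 ≤ P' R) (hlam1 : lam ≤ 1)
    (hΔ : ∀ R, zO * z' R ≤ zO' * (lam * z R + (1 - lam) * zO)) :
    zO * ∑ R ∈ univ.filter (fun R => (R, false) ∈ U), P' R * z' R ≤
      zO' * ∑ c ∈ U, (if c.2 then (1 - lam) * P' c.1 * zO else lam * P' c.1 * z c.1) := by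
  classical
  -- Step 1: the U-sum dominates the "collapsed" sum over cells R with (R,false) ∈ U.
  have hsplit : ∑ c ∈ U, (if c.2 then (1 - lam) * P' c.1 * zO else lam * P' c.1 * z c.1)
      = (∑ c ∈ U.filter (fun c => c.2 = true), (1 - lam) * P' c.1 * zO)
        + ∑ c ∈ U.filter (fun c => c.2 = false), lam * P' c.1 * z c.1 := by
    rw [← Finset.sum_filter_add_sum_filter_not U (fun c => c.2 = true)]
    congr 1
    · exact Finset.sum_congr rfl fun c hc => by rw [(Finset.mem_filter.1 hc).2]; rfl
    · refine Finset.sum_congr ?_ fun c hc => ?_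
      · ext c; simp
      · have : c.2 = false := by simpa using (Finset.mem_filter.1 hc).2
        rw [this]; rfl
  -- the cells (R,true) with (R,false) ∈ U form a subset of U ∩ {top open}; their contribution is nonnegative termwise
  set S0 := univ.filter (fun R : N => (R, false) ∈ U) with hS0
  have hinj : ∑ R ∈ S0, (1 - lam) * P' R * zO ≤ ∑ c ∈ U.filter (fun c => c.2 = true), (1 - lam) * P' c.1 * zO := by
    have hmap : ∑ R ∈ S0, (1 - lam) * P' R * zO
        = ∑ c ∈ S0.image (fun R => (R, true)), (1 - lam) * P' c.1 * zO := by
      rw [Finset.sum_image]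
      intro x _ y _ h
      exact (Prod.mk.inj h).1
    rw [hmap]
    apply Finset.sum_le_sum_of_subset_of_nonneg
    · intro c hc
      obtain ⟨R, hR, rfl⟩ := Finset.mem_image.1 hc
      have hR' : (R, false) ∈ U := (Finset.mem_filter.1 hR).2
      exact Finset.mem_filter.2 ⟨hU R hR', rfl⟩
    · intro c _ _
      have : 0 ≤ 1 - lam := by linarith
      exact mul_nonneg (mul_nonneg this (hP c.1)) hzO
  have hlow : ∑ c ∈ U.filter (fun c => c.2 = false), lam * P' c.1 * z c.1 = ∑ R ∈ S0, lam * P' R * z R := by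
    have hmap : ∑ R ∈ S0, lam * P' R * z R = ∑ c ∈ S0.image (fun R => (R, false)), lam * P' c.1 * z c.1 := by
      rw [Finset.sum_image]
      intro x _ y _ h
      exact (Prod.mk.inj h).1
    rw [hmap]
    refine Finset.sum_congr ?_ fun _ _ => rfl
    ext ⟨R, b⟩
    simp only [Finset.mem_filter, Finset.mem_image, hS0, Finset.mem_univ, true_and, Prod.mk.injEq]
    constructor
    · rintro ⟨h, hb⟩; subst hb; exact ⟨R, h, rfl, rfl⟩
    · rintro ⟨R', h, rfl, hb⟩; exact ⟨hb ▸ h, hb.symm⟩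
  -- Step 2: collapsed sum = Σ_{S0} P' R · ẑ R, and termwise domination.
  have hcoll : ∑ R ∈ S0, P' R * (lam * z R + (1 - lam) * zO)
      ≤ ∑ c ∈ U, (if c.2 then (1 - lam) * P' c.1 * zO else lam * P' c.1 * z c.1) := by
    rw [hsplit, hlow]
    have : ∑ R ∈ S0, P' R * (lam * z R + (1 - lam) * zO)
        = (∑ R ∈ S0, (1 - lam) * P' R * zO) + ∑ R ∈ S0, lam * P' R * z R := by
      rw [← Finset.sum_add_distrib]
      exact Finset.sum_congr rfl fun R _ => by ring
    rw [this]
    linarith [hinj]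
  calc zO * ∑ R ∈ S0, P' R * z' R
      = ∑ R ∈ S0, P' R * (zO * z' R) := by rw [Finset.mul_sum]; exact Finset.sum_congr rfl fun R _ => by ring
    _ ≤ ∑ R ∈ S0, P' R * (zO' * (lam * z R + (1 - lam) * zO)) :=
        Finset.sum_le_sum fun R _ => mul_le_mul_of_nonneg_left (hΔ R) (hP R)
    _ = zO' * ∑ R ∈ S0, P' R * (lam * z R + (1 - lam) * zO) := by
        rw [Finset.mul_sum]; exact Finset.sum_congr rfl fun R _ => by ring
    _ ≤ zO' * ∑ c ∈ U, (if c.2 then (1 - lam) * P' c.1 * zO else lam * P' c.1 * z c.1) :=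
        mul_le_mul_of_nonneg_left hcoll hzO'

end SahiFreeSlot

end Summit.CriticalPhenomena.PercolationContinuityZ3.Theorems
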